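import Summits.QuantumFields.BalabanUV.Beta.GAN24.Lin4Additive
import Summits.QuantumFields.BalabanUV.Beta.KernelWardSwap
import Summits.QuantumFields.BalabanUV.Beta.WardLocusCubic
import Summits.QuantumFields.BalabanUV.Beta.ValueJetGeneric
import Summits.QuantumFields.BalabanUV.Beta.HessKerDressedUnits
import Summits.QuantumFields.BalabanUV.Beta.GAN24.CombesThomas

/-!
# `BalabanUV.Beta.GAN24.Lin4SlotDivergence` — binder row G-an2-4 ∕ (CONV-C), CT-W (W slot of the one-step rate comparison): THE COARSE
# PURE-GAUGE SLICE OF THE LINEAR STEP `lin4` IN A SOURCE SLOT IS THE S-SLOT MAP `e3OfK` OF THE BLOCK-SUMMED FINE PURE-GAUGE SLICE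
# (the kernel content of «T-EQ», WARD3-GAN24 §2 (2.1) ∕ §3 (3.2) «|S| = 1, source slot»; G-an2-4 formalisation swarm, leaf prover
# `b2b-balaban-gan24-formalise-leaf-03`, gen 58; module name PROVISIONAL — the row owner gan24-p1 may rename ∕ re-home it)

NOT IN PRINT; OUR BOOKKEEPING.  HONEST FRAMING (cell contract, verbatim): «discharging `BetaPertH` makes Bałaban's UV stability
UNCONDITIONAL — a real constructive-QFT result; it is NOT the continuum limit and NOT the Clay problem.»  HONEST DEPENDENCY (verbatim):
«continuum YM on T⁴ ⇐ BetaPertH ∧ nine spine estimates (0/9 proved); BetaPertH ⇐ (D1) ∧ (D4) ∧ CAP+tail; G-an2-4 gates asym, D1 and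
NE2/3/4.»

WHY.  The OWNER's located END shape for CT-W (R-gan24p1-g23-6, journal l.38432) admits the dressed step `𝒜^E_j = lin4 c G♮_j Lc` only
through (α) the full affine step on the orbit and (β) IDENTITIES rewriting it through Ward objects; idea-1's «WARD CASCADE» (`WARD3-GAN24.md`
v1.0 §2) locates the lever: the ℋ-column Ward law (hH) of the wall's co-dressed resolvent (d1-leaf-07's
`KernelWardHColumnWall.colH_ward_KInvStep_all`, every step, every in-block root) makes the SLOT DIVERGENCES of a table FACTOR through the
linear step.  At the VERTEX level that lever is already in the tree on the D1 side — d1-leaf-10's (B1) `WardLocusSecondOrder.divW_vertex2OfK`,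
`WardLocusSecondOrderLaw.sum_divV_vertexOfK_eq` and the Fubini swap `KernelWardSwap.vertex2OfK_swap_eq_transpose` (all BY NAME below).  This
module carries it through leaf-04's symmetrisation `vsym`, the resolvent sandwich and the `mm`-read of `T2RecursionAffine.lin4`, as
UNCONDITIONAL kernel algebra on leaf-01's bounded-table class (`Lin4Additive`): for ANY decaying packed kernel `K` (rate `δ > 0`), nonzero
blocking `N`, scalar `c`, any bi-table `T` with bounded entries, UNDER (hH) `Σ_μ (colH K N μ (y − e_μ) κ′ u − colH K N μ y κ′ u) = c_H · gaugeWt N y κ′ u`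
(a HYPOTHESIS of §1–§2, DISCHARGED for the comb ∕ wall instance in §3):

* §0 the sandwich `V ↦ mmRead N (K ∘ V ∘ K)` on bounded kernels (`sandwich_sub`, `sandwich_finset_sum`), `e3OfK_eq_neg_sandwich`, entry bounds;
* §1 the bi-vertex in FACTOR form: **`divW_vertex2OfK_factor`** (outer source slot)
  `divW (vertex2OfK K N T) y ν y′ = c_H • vertexOfK K N (κ′ u′ ↦ Σ_{v ∈ box (d+1) N} divV (κ u ↦ T κ u κ′ u′) (N•y + toSite v)) ν y′`,
  **`divV_vertex2OfK_swap_factor`** (inner source slot) `divV (μ w ↦ vertex2OfK K N T ν y′ μ w) y = c_H • vertexOfK K N (κ u ↦ Σ_{v ∈ box} divV (T κ u) (N•y + toSite v)) ν y′`,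
  and **`divW_vsym`** `divW (vsym K N T) y ν y′ = (c_H ∕ 2) • (outer + inner)`;
* §2 the linear step: `lin4_swap_slots` (the second output bond is the first), `divW_lin4_eq_sandwich`, **`divW_lin4`**
  `divW (lin4 c K N T) y ν y′ = (c·c_H ∕ 2) • (e3OfK N K F₁ ν y′ + e3OfK N K F₂ ν y′)` with the two block-summed fine-slice families `F₁`, `F₂`
  of §1, and for a `(μ,y) ↔ (ν,y′)`-SYMMETRIC table **`divW_lin4_of_symm`** `divW (lin4 c K N T) y ν y′ = (c·c_H) • e3OfK N K F₂ ν y′` —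
  the coarse pure-gauge slice (`KernelWard.divW`) of the linear step is an5's S-slot map `SpineRooted.e3OfK` (the linear part of an2's
  `SpureRecAt` recursion) applied to the block-summed FINE pure-gauge slices `κ u ↦ Σ_{v ∈ box} divV (T κ u) (N•y + toSite v)`, the coarse site
  `y` a passive label: WARD3's `div_s (𝒜 X) = 𝒜^{(s)} (𝔹_s div_s X)` with `𝒜^{(s)} = (c·c_H) • e3OfK N K`;
* §3 THE COMB ∕ WALL INSTANCE: `sfStep_mul_smStep`, **`hH_unitK_comb`** — (hH) for `K♮ᴱ_j := unitK (sfStep Lc j) (smStep d Lc j) (coDressKBmAt (toSite r) Lc (KInvStep Lc j))`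
  at `N := Lc`, every `j`, every `r ∈ box (d+1) Lc`, with the `j`-FREE constant `c_H = (Lc^{d+1})⁻¹` (the units' `sfStep·smStep = stepScale`
  cancels the `stepScale` of d1-leaf-07's `c_H(j) = (stepScale·Lc^{d+1})⁻¹`, asym1's `colH_unitK`) — and **`divW_lin4_comb`**,
  **`divW_lin4_comb_of_symm`**: §2 for the dressed comb step `lin4 c K♮ᴱ_j Lc` of an2's `T2RecAt` (leaf-06's `LinT2CoDressedStep` instance),
  every level with the same constant, any `c`.

[folklore] kernel algebra BY NAME; 0 `def`, 0 cite, 0 `def … : Prop`, 0 sorry.  NOT typed here: the kernel-LEG slots (WARD3 (E-leg),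
`KernelWardResponse.row_comp_ward`), the tower identity on `T2RecAt` (T-CASC), any contraction ∕ drift row (A-S), the charge row (C).  Asserts
NO shape or rate of Bałaban's tables; decides nothing about RULING R-gan24p1-g23-3 (iii) by itself; discharges NOTHING of «T2Shape» ∕
«T2Drift» ∕ (hW, hWall); 0 wall binders; NEVER «G-an2-4 closed» as (CONV-C); NOT D1, NOT `BetaPertH`, NOT continuum, NOT Clay; not in print —
our bookkeeping (nearest print: Bałaban's W-T identity family, CMP 109 (1987) §4 (4.9)–(4.15); the factor-map form is not found there).
Unit `b2b-balaban-gan24-formalise-leaf-03` (gen 58), 2026-08-22.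
-/

noncomputable section

open Finset
open scoped BigOperators
open Literature.MathematicalPhysics.QuantumFieldTheory
open Literature.MathematicalPhysics.QuantumFieldTheory.Balaban1983to89
open Literature.MathematicalPhysics.QuantumFieldTheory.Balaban1983to89.Beta
open B6BondElimination (unitVec)
open ExpKernelCalculus (MKer Decays comp)
open OneStepResolventKernel (Fib)
open OneStepKernelFamily (colH vertexOfK KInvStep)
open SecondOrderResponse (vertex2OfK)
open BalabanStepJetsSucc (mmRead)
open KernelWard (divV divW Bdd comp_sub_right comp_sub_left comp_finset_sum_right comp_finset_sum_left)
open AffineAveraging (box toSite)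
open Summit.QuantumFields.BalabanUV.Beta.KernelWardRelative (gaugeWt)
open Summit.QuantumFields.BalabanUV.Beta.SecondOrderUnits (vertexOfK_smul_table)
open Summit.QuantumFields.BalabanUV.Beta.WardLocusSecondOrder (divW_vertex2OfK)
open Summit.QuantumFields.BalabanUV.Beta.WardLocusSecondOrderLaw (sum_divV_vertexOfK_eq)
open Summit.QuantumFields.BalabanUV.Beta.KernelWardSwap (vertex2OfK_swap_eq_transpose)
open Summit.QuantumFields.BalabanUV.Beta.WardLocusCubic (mmRead_finset_sum)
open Summit.QuantumFields.BalabanUV.Beta.GAN24.ThirdJetKernel (mmRead_smul mmRead_sub)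
open Summit.QuantumFields.BalabanUV.Beta.VertexReflectionContact (comp_add_left mmRead_add)
open StepJetData (comp_add_right)
open Summit.QuantumFields.BalabanUV.Beta.GAN24.T2RecursionAffine (vsym lin4 lin4_apply)
open Summit.QuantumFields.BalabanUV.Beta.GAN24.Lin4Additive (abs_vertexOfK_le abs_vsym_le summable_slices_decays_bdd summable_slices_bdd_decays
  bdd_comp_decays_bdd)
open Summit.QuantumFields.BalabanUV.Beta.SpineRooted (e3OfK e3OfK_apply)
open Summit.QuantumFields.BalabanUV.Beta.HessKerDressedUnits (unitK colH_unitK decays_unitK)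
open Summit.QuantumFields.BalabanUV.Beta.GAN24.CombesThomas (sfStep smStep)
open Summit.QuantumFields.BalabanUV.Beta.BorderedHessian (stepScale)
open Summit.QuantumFields.BalabanUV.Beta.AxialDressingRooted (coDressKBmAt decays_coDressKBmAt_KInvStep)
open Summit.QuantumFields.BalabanUV.Beta.KernelWardHColumnWall (colH_ward_KInvStep_all)

namespace Summit.QuantumFields.BalabanUV.Beta.GAN24.Lin4SlotDivergence

variable {d N : ℕ}

/-! ## §0 The sandwich on bounded kernels; entry bounds -/

/-- [folklore] A bounded first-order family has bounded pure-gauge vertices: `|divV S w …| ≤ (d+1)·(B+B)`. -/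
theorem abs_divV_le {S : Fin (d + 1) → (Fin (d + 1) → ℤ) → MKer (d + 1) (Fib d)} {B : ℝ}
    (hS : ∀ κ u x z a b, |S κ u x z a b| ≤ B) (w x z : Fin (d + 1) → ℤ) (a b : Fib d) :
    |divV S w x z a b| ≤ ((d + 1 : ℕ) : ℝ) * (B + B) := by
  simp only [KernelWard.divV, Finset.sum_apply, Pi.sub_apply]
  calc |∑ μ : Fin (d + 1), (S μ (w - unitVec μ) x z a b - S μ w x z a b)|
      ≤ ∑ μ : Fin (d + 1), |S μ (w - unitVec μ) x z a b - S μ w x z a b| := Finset.abs_sum_le_sum_abs _ _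
    _ ≤ ∑ _μ : Fin (d + 1), (B + B) := Finset.sum_le_sum fun μ _ =>
        (abs_sub _ _).trans (add_le_add (hS _ _ _ _ _ _) (hS _ _ _ _ _ _))
    _ = ((d + 1 : ℕ) : ℝ) * (B + B) := by rw [Finset.sum_const, Finset.card_univ, Fintype.card_fin, nsmul_eq_mul]

/-- [folklore] A finite sum of uniformly bounded kernels is bounded by `card · bound`. -/
theorem abs_finset_sum_le {ι : Type*} (s : Finset ι) {F : ι → MKer (d + 1) (Fib d)} {B : ℝ}
    (hF : ∀ i x z a b, |F i x z a b| ≤ B) (x z : Fin (d + 1) → ℤ) (a b : Fib d) :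
    |(∑ i ∈ s, F i) x z a b| ≤ (s.card : ℝ) * B := by
  simp only [Finset.sum_apply]
  calc |∑ i ∈ s, F i x z a b| ≤ ∑ i ∈ s, |F i x z a b| := Finset.abs_sum_le_sum_abs _ _
    _ ≤ ∑ _i ∈ s, B := Finset.sum_le_sum fun i _ => hF i x z a b
    _ = (s.card : ℝ) * B := by rw [Finset.sum_const, nsmul_eq_mul]

/-- [folklore] The BLOCK-SUMMED FINE PURE-GAUGE VERTICES of a bounded table family are bounded (`card (box) · (d+1) · 2B`). -/
theorem abs_boxSum_divV_le {T : Fin (d + 1) → (Fin (d + 1) → ℤ) → Fin (d + 1) → (Fin (d + 1) → ℤ) → MKer (d + 1) (Fib d)} {B : ℝ}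
    (hT : ∀ κ u κ' u' x z a b, |T κ u κ' u' x z a b| ≤ B) (y : Fin (d + 1) → ℤ) (κ : Fin (d + 1)) (u x z : Fin (d + 1) → ℤ)
    (a b : Fib d) :
    |(∑ v ∈ box (d + 1) N, divV (T κ u) ((N : ℤ) • y + toSite v)) x z a b| ≤ ((box (d + 1) N).card : ℝ) * (((d + 1 : ℕ) : ℝ) * (B + B)) :=
  abs_finset_sum_le (box (d + 1) N) (F := fun v => divV (T κ u) ((N : ℤ) • y + toSite v)) (fun _ x z a b => abs_divV_le (hT κ u) _ x z a b)
    x z a b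

/-- [folklore] THE SANDWICH `V ↦ mmRead N (K ∘ V ∘ K)` IS SUBTRACTIVE ON BOUNDED KERNELS (decaying `K`, rate `δ > 0`; slices summable by
leaf-01's `summable_slices_decays_bdd` ∕ `summable_slices_bdd_decays`, pv's `KernelWard.comp_sub_right/left`, `mmRead_sub`). -/
theorem sandwich_sub {K : MKer (d + 1) (Fib d)} {C δ : ℝ} (hK : Decays K C δ) (hδ : 0 < δ) (N : ℕ) {V W : MKer (d + 1) (Fib d)}
    {BV BW : ℝ} (hV : Bdd V BV) (hW : Bdd W BW) :
    mmRead N (comp (comp K (V - W)) K) = mmRead N (comp (comp K V) K) - mmRead N (comp (comp K W) K) := by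
  rw [comp_sub_right (summable_slices_decays_bdd hK hδ hV) (summable_slices_decays_bdd hK hδ hW),
    comp_sub_left (summable_slices_bdd_decays (bdd_comp_decays_bdd hK hδ hV) hK hδ)
      (summable_slices_bdd_decays (bdd_comp_decays_bdd hK hδ hW) hK hδ), mmRead_sub]

/-- [folklore] THE SANDWICH IS ADDITIVE OVER FINITE SUMS OF BOUNDED KERNELS (`KernelWard.comp_finset_sum_right/left`, an1's `mmRead_finset_sum`). -/
theorem sandwich_finset_sum {ι : Type*} (s : Finset ι) {K : MKer (d + 1) (Fib d)} {C δ : ℝ} (hK : Decays K C δ) (hδ : 0 < δ) (N : ℕ)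
    {V : ι → MKer (d + 1) (Fib d)} {B : ι → ℝ} (hV : ∀ i, Bdd (V i) (B i)) :
    mmRead N (comp (comp K (∑ i ∈ s, V i)) K) = ∑ i ∈ s, mmRead N (comp (comp K (V i)) K) := by
  rw [comp_finset_sum_right s (fun i _ => summable_slices_decays_bdd hK hδ (hV i)),
    comp_finset_sum_left s (fun i _ => summable_slices_bdd_decays (bdd_comp_decays_bdd hK hδ (hV i)) hK hδ), mmRead_finset_sum]

/-- [folklore] an5's S-slot map is minus the sandwich of the chain-rule vertex: `e3OfK N K F ν y′ = −mmRead N (K ∘ vertexOfK K N F ν y′ ∘ K)`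
(`ValueJetGeneric.e3OfK_apply`, as kernels). -/
theorem e3OfK_eq_neg_sandwich (N : ℕ) (K : MKer (d + 1) (Fib d)) (F : Fin (d + 1) → (Fin (d + 1) → ℤ) → MKer (d + 1) (Fib d))
    (ν : Fin (d + 1)) (y' : Fin (d + 1) → ℤ) : e3OfK N K F ν y' = -mmRead N (comp (comp K (vertexOfK K N F ν y')) K) := by
  funext x' z' a b
  simp only [e3OfK_apply, Pi.neg_apply]

/-! ## §1 The pure-gauge slices of the bi-vertex, in factor form, and of leaf-04's symmetrised bi-vertex -/

section BiVertex

variable [NeZero N] {K : MKer (d + 1) (Fib d)} {C δ : ℝ}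
  {T : Fin (d + 1) → (Fin (d + 1) → ℤ) → Fin (d + 1) → (Fin (d + 1) → ℤ) → MKer (d + 1) (Fib d)} {B : ℝ} {cH : ℝ}

/-- [folklore] **OUTER SOURCE SLOT, FACTOR FORM** (d1-leaf-10's (B1) `divW_vertex2OfK` + `sum_divV_vertexOfK_eq` BY NAME): the coarse
pure-gauge slice of the bi-vertex in its FIRST bond is `c_H` × the chain-rule vertex (second bond) of the BLOCK-SUMMED FINE pure-gauge slice
of the table in its first slot — the ℋ-column of that slot is replaced by the scalar weight `c_H · 1_{B(y)}`, the other slot untouched: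
`divW (vertex2OfK K N T) y ν y′ = c_H • vertexOfK K N (κ′ u′ ↦ Σ_{v ∈ box (d+1) N} divV (κ u ↦ T κ u κ′ u′) (N•y + toSite v)) ν y′`. -/
theorem divW_vertex2OfK_factor (hK : Decays K C δ) (hδ : 0 < δ) (hT : ∀ κ u κ' u' x z a b, |T κ u κ' u' x z a b| ≤ B)
    (hH : ∀ (y : Fin (d + 1) → ℤ) (κ' : Fin (d + 1)) (u : Fin (d + 1) → ℤ),
      ∑ μ, (colH K N μ (y - unitVec μ) κ' u - colH K N μ y κ' u) = cH * gaugeWt N y κ' u)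
    (y : Fin (d + 1) → ℤ) (ν : Fin (d + 1)) (y' : Fin (d + 1) → ℤ) :
    divW (vertex2OfK K N T) y ν y'
      = cH • vertexOfK K N (fun κ' u' => ∑ v ∈ box (d + 1) N, divV (fun κ u => T κ u κ' u') ((N : ℤ) • y + toSite v)) ν y' := by
  have hKex : ∃ δ C : ℝ, 0 < δ ∧ 0 ≤ C ∧ Decays K C δ := ⟨δ, C, hδ, hK.nonneg (Sum.inl 0), hK⟩
  rw [divW_vertex2OfK hKex hT cH hH y ν y', sum_divV_vertexOfK_eq hKex hT y ν y']

/-- [folklore] **INNER SOURCE SLOT, FACTOR FORM** (d1-leaf-10's Fubini swap `KernelWardSwap.vertex2OfK_swap_eq_transpose` + the outer form for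
the transposed table): the coarse pure-gauge slice of the EXCHANGED bi-vertex `(μ, w) ↦ vertex2OfK K N T ν y′ μ w` is `c_H` × the chain-rule
vertex (at `(ν, y′)`) of the family of BLOCK-SUMMED FINE pure-gauge vertices of the slices `T κ u`:
`divV (μ w ↦ vertex2OfK K N T ν y′ μ w) y = c_H • vertexOfK K N (κ u ↦ Σ_{v ∈ box (d+1) N} divV (T κ u) (N•y + toSite v)) ν y′`. -/
theorem divV_vertex2OfK_swap_factor (hK : Decays K C δ) (hδ : 0 < δ) (hT : ∀ κ u κ' u' x z a b, |T κ u κ' u' x z a b| ≤ B)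
    (hH : ∀ (y : Fin (d + 1) → ℤ) (κ' : Fin (d + 1)) (u : Fin (d + 1) → ℤ),
      ∑ μ, (colH K N μ (y - unitVec μ) κ' u - colH K N μ y κ' u) = cH * gaugeWt N y κ' u)
    (y : Fin (d + 1) → ℤ) (ν : Fin (d + 1)) (y' : Fin (d + 1) → ℤ) :
    divV (fun μ w => vertex2OfK K N T ν y' μ w) y
      = cH • vertexOfK K N (fun κ u => ∑ v ∈ box (d + 1) N, divV (T κ u) ((N : ℤ) • y + toSite v)) ν y' := by
  have hKex : ∃ δ C : ℝ, 0 < δ ∧ 0 ≤ C ∧ Decays K C δ := ⟨δ, C, hδ, hK.nonneg (Sum.inl 0), hK⟩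
  -- the swapped bi-vertex is the direct bi-vertex of the transposed table
  have eW : divV (fun μ w => vertex2OfK K N T ν y' μ w) y = divW (vertex2OfK K N (fun κ' u' κ u => T κ u κ' u')) y ν y' := by
    simp only [KernelWard.divV, KernelWard.divW, vertex2OfK_swap_eq_transpose hKex hT]
  rw [eW]
  exact divW_vertex2OfK_factor hK hδ (fun κ' u' κ u x z a b => hT κ u κ' u' x z a b) hH y ν y'

/-- [folklore] **THE PURE-GAUGE SLICE OF leaf-04's SYMMETRISED BI-VERTEX**: `divW (vsym K N T) y ν y′ = (c_H ∕ 2) • (V₁ + V₂)` with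
`V₁ := vertexOfK K N (κ′ u′ ↦ Σ_{v ∈ box} divV (κ u ↦ T κ u κ′ u′) (N•y + toSite v)) ν y′` (outer slot) and
`V₂ := vertexOfK K N (κ u ↦ Σ_{v ∈ box} divV (T κ u) (N•y + toSite v)) ν y′` (inner slot). -/
theorem divW_vsym (hK : Decays K C δ) (hδ : 0 < δ) (hT : ∀ κ u κ' u' x z a b, |T κ u κ' u' x z a b| ≤ B)
    (hH : ∀ (y : Fin (d + 1) → ℤ) (κ' : Fin (d + 1)) (u : Fin (d + 1) → ℤ),
      ∑ μ, (colH K N μ (y - unitVec μ) κ' u - colH K N μ y κ' u) = cH * gaugeWt N y κ' u)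
    (y : Fin (d + 1) → ℤ) (ν : Fin (d + 1)) (y' : Fin (d + 1) → ℤ) :
    divW (vsym K N T) y ν y' = (cH / 2) •
      (vertexOfK K N (fun κ' u' => ∑ v ∈ box (d + 1) N, divV (fun κ u => T κ u κ' u') ((N : ℤ) • y + toSite v)) ν y'
        + vertexOfK K N (fun κ u => ∑ v ∈ box (d + 1) N, divV (T κ u) ((N : ℤ) • y + toSite v)) ν y') := by
  have e : divW (vsym K N T) y ν y'
      = (1 / 2 : ℝ) • (divW (vertex2OfK K N T) y ν y' + divV (fun μ w => vertex2OfK K N T ν y' μ w) y) := by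
    funext x z a b
    simp only [KernelWard.divW, KernelWard.divV, vsym, Finset.sum_apply, Pi.sub_apply, Pi.smul_apply, Pi.add_apply, smul_eq_mul,
      Finset.mul_sum, ← Finset.sum_add_distrib]
    refine Finset.sum_congr rfl fun μ _ => ?_
    ring
  rw [e, divW_vertex2OfK_factor hK hδ hT hH, divV_vertex2OfK_swap_factor hK hδ hT hH, ← smul_add, smul_smul]
  congr 1
  ring

end BiVertex

/-! ## §2 The pure-gauge slice of the linear step `lin4` -/

section Lin

variable {K : MKer (d + 1) (Fib d)} {C δ : ℝ} {T : Fin (d + 1) → (Fin (d + 1) → ℤ) → Fin (d + 1) → (Fin (d + 1) → ℤ) → MKer (d + 1) (Fib d)}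
  {B : ℝ} {cH : ℝ}

/-- [folklore] `lin4` IS SYMMETRIC IN ITS TWO OUTPUT BONDS (leaf-04's `vsym` is): `lin4 c K N T κ u κ′ u′ = lin4 c K N T κ′ u′ κ u` — the
pure-gauge slice in the second output bond is the one in the first. -/
theorem lin4_swap_slots (c : ℝ) (K : MKer (d + 1) (Fib d)) (N : ℕ)
    (T : Fin (d + 1) → (Fin (d + 1) → ℤ) → Fin (d + 1) → (Fin (d + 1) → ℤ) → MKer (d + 1) (Fib d))
    (κ : Fin (d + 1)) (u : Fin (d + 1) → ℤ) (κ' : Fin (d + 1)) (u' : Fin (d + 1) → ℤ) :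
    lin4 c K N T κ u κ' u' = lin4 c K N T κ' u' κ u := by
  have h : vsym K N T κ u κ' u' = vsym K N T κ' u' κ u := by
    simp only [vsym]
    congr 1
    exact add_comm _ _
  rw [lin4_apply, lin4_apply, h]

/-- [folklore] **THE PURE-GAUGE SLICE PASSES THROUGH THE SANDWICH**: `divW (lin4 c K N T) y ν y′ = −(c • mmRead N (K ∘ divW (vsym K N T) y ν y′ ∘ K))`
(a finite sum of differences of bounded kernels — leaf-01's `abs_vsym_le`; `sandwich_sub`, `sandwich_finset_sum`). -/
theorem divW_lin4_eq_sandwich (hK : Decays K C δ) (hδ : 0 < δ) (c : ℝ) (N : ℕ) (hT : ∀ κ u κ' u' x z a b, |T κ u κ' u' x z a b| ≤ B)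
    (y : Fin (d + 1) → ℤ) (ν : Fin (d + 1)) (y' : Fin (d + 1) → ℤ) :
    divW (lin4 c K N T) y ν y' = -(c • mmRead N (comp (comp K (divW (vsym K N T) y ν y')) K)) := by
  set B₂ : ℝ := ((d + 1 : ℕ) : ℝ) * (C * ExpKernelCalculus.Zl (d + 1) δ * (((d + 1 : ℕ) : ℝ) * (C * ExpKernelCalculus.Zl (d + 1) δ * B)))
  have hV : ∀ (μ : Fin (d + 1)) (w : Fin (d + 1) → ℤ), Bdd (vsym K N T μ w ν y') B₂ :=
    fun μ w x z a b => abs_vsym_le hK hδ N hT μ w ν y' x z a b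
  have hD : ∀ μ : Fin (d + 1), Bdd (vsym K N T μ (y - unitVec μ) ν y' - vsym K N T μ y ν y') (B₂ + B₂) := by
    intro μ x z a b
    simp only [Pi.sub_apply]
    exact (abs_sub _ _).trans (add_le_add (hV μ _ x z a b) (hV μ y x z a b))
  have e1 : divW (vsym K N T) y ν y' = ∑ μ, (vsym K N T μ (y - unitVec μ) ν y' - vsym K N T μ y ν y') := rfl
  rw [e1, sandwich_finset_sum Finset.univ hK hδ N hD]
  simp only [KernelWard.divW, lin4_apply, Finset.smul_sum, ← Finset.sum_neg_distrib]
  refine Finset.sum_congr rfl fun μ _ => ?_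
  rw [sandwich_sub hK hδ N (hV μ (y - unitVec μ)) (hV μ y), smul_sub, neg_sub', sub_eq_add_neg]

variable [NeZero N]

/-- [folklore] **T-EQ, SOURCE SLOT — THE COARSE PURE-GAUGE SLICE OF THE LINEAR STEP IS THE S-SLOT MAP OF THE BLOCK-SUMMED FINE SLICES**:
for a decaying `K` (rate `δ > 0`), nonzero `N`, a bounded bi-table `T`, any `c`, under (hH) with constant `c_H`,
`divW (lin4 c K N T) y ν y′ = (c·c_H ∕ 2) • (e3OfK N K (κ′ u′ ↦ Σ_{v ∈ box} divV (κ u ↦ T κ u κ′ u′) (N•y + toSite v)) ν y′ + e3OfK N K (κ u ↦ Σ_{v ∈ box} divV (T κ u) (N•y + toSite v)) ν y′)`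
— the two halves are the outer ∕ inner source slots of leaf-04's symmetrisation; the coarse site `y` is a passive label of the stencil
families on the right (WARD3 §3 (3.2) «|S| = 1, source slot»). -/
theorem divW_lin4 (hK : Decays K C δ) (hδ : 0 < δ) (c : ℝ) (hT : ∀ κ u κ' u' x z a b, |T κ u κ' u' x z a b| ≤ B)
    (hH : ∀ (y : Fin (d + 1) → ℤ) (κ' : Fin (d + 1)) (u : Fin (d + 1) → ℤ),
      ∑ μ, (colH K N μ (y - unitVec μ) κ' u - colH K N μ y κ' u) = cH * gaugeWt N y κ' u)
    (y : Fin (d + 1) → ℤ) (ν : Fin (d + 1)) (y' : Fin (d + 1) → ℤ) :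
    divW (lin4 c K N T) y ν y' = (c * cH / 2) •
      (e3OfK N K (fun κ' u' => ∑ v ∈ box (d + 1) N, divV (fun κ u => T κ u κ' u') ((N : ℤ) • y + toSite v)) ν y'
        + e3OfK N K (fun κ u => ∑ v ∈ box (d + 1) N, divV (T κ u) ((N : ℤ) • y + toSite v)) ν y') := by
  -- the two block-summed families are bounded, hence so are their chain-rule vertices
  have hF₁ : ∀ κ' u' x z a b, |(fun κ' u' => ∑ v ∈ box (d + 1) N, divV (fun κ u => T κ u κ' u') ((N : ℤ) • y + toSite v)) κ' u' x z a b|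
      ≤ ((box (d + 1) N).card : ℝ) * (((d + 1 : ℕ) : ℝ) * (B + B)) := fun κ' u' x z a b =>
    abs_boxSum_divV_le (T := fun κ' u' κ u => T κ u κ' u') (fun κ' u' κ u x z a b => hT κ u κ' u' x z a b) y κ' u' x z a b
  have hF₂ : ∀ κ u x z a b, |(fun κ u => ∑ v ∈ box (d + 1) N, divV (T κ u) ((N : ℤ) • y + toSite v)) κ u x z a b|
      ≤ ((box (d + 1) N).card : ℝ) * (((d + 1 : ℕ) : ℝ) * (B + B)) := fun κ u x z a b => abs_boxSum_divV_le hT y κ u x z a b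
  have hV₁ : Bdd (vertexOfK K N (fun κ' u' => ∑ v ∈ box (d + 1) N, divV (fun κ u => T κ u κ' u') ((N : ℤ) • y + toSite v)) ν y') _ :=
    fun x z a b => abs_vertexOfK_le hK hδ N hF₁ ν y' x z a b
  have hV₂ : Bdd (vertexOfK K N (fun κ u => ∑ v ∈ box (d + 1) N, divV (T κ u) ((N : ℤ) • y + toSite v)) ν y') _ :=
    fun x z a b => abs_vertexOfK_le hK hδ N hF₂ ν y' x z a b
  rw [divW_lin4_eq_sandwich hK hδ c N hT, divW_vsym hK hδ hT hH, KernelReflection.comp_smul_right, KernelReflection.comp_smul_left,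
    mmRead_smul, comp_add_right (summable_slices_decays_bdd hK hδ hV₁) (summable_slices_decays_bdd hK hδ hV₂),
    comp_add_left (summable_slices_bdd_decays (bdd_comp_decays_bdd hK hδ hV₁) hK hδ)
      (summable_slices_bdd_decays (bdd_comp_decays_bdd hK hδ hV₂) hK hδ),
    mmRead_add, e3OfK_eq_neg_sandwich, e3OfK_eq_neg_sandwich, smul_smul, show c * (cH / 2) = c * cH / 2 by ring, smul_add, smul_add,
    smul_neg, smul_neg, neg_add]

/-- [folklore] **T-EQ, SOURCE SLOT, SYMMETRIC TABLE**: if `T κ u κ′ u′ = T κ′ u′ κ u` (the index symmetry of an2's towers) the two halves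
coincide: `divW (lin4 c K N T) y ν y′ = (c·c_H) • e3OfK N K (κ u ↦ Σ_{v ∈ box (d+1) N} divV (T κ u) (N•y + toSite v)) ν y′` — WARD3 (2.1) for the
source slots, `div_s (𝒜 X) = 𝒜^{(s)} (𝔹_s div_s X)` with `𝒜^{(s)}` = the S-slot map `(c·c_H) • e3OfK N K`, the block label passive. -/
theorem divW_lin4_of_symm (hK : Decays K C δ) (hδ : 0 < δ) (c : ℝ) (hT : ∀ κ u κ' u' x z a b, |T κ u κ' u' x z a b| ≤ B)
    (hsym : ∀ κ u κ' u', T κ u κ' u' = T κ' u' κ u)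
    (hH : ∀ (y : Fin (d + 1) → ℤ) (κ' : Fin (d + 1)) (u : Fin (d + 1) → ℤ),
      ∑ μ, (colH K N μ (y - unitVec μ) κ' u - colH K N μ y κ' u) = cH * gaugeWt N y κ' u)
    (y : Fin (d + 1) → ℤ) (ν : Fin (d + 1)) (y' : Fin (d + 1) → ℤ) :
    divW (lin4 c K N T) y ν y'
      = (c * cH) • e3OfK N K (fun κ u => ∑ v ∈ box (d + 1) N, divV (T κ u) ((N : ℤ) • y + toSite v)) ν y' := by
  have e : (fun κ' u' => ∑ v ∈ box (d + 1) N, divV (fun κ u => T κ u κ' u') ((N : ℤ) • y + toSite v))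
      = fun κ u => ∑ v ∈ box (d + 1) N, divV (T κ u) ((N : ℤ) • y + toSite v) := by
    funext κ' u'
    have hTs : (fun κ u => T κ u κ' u') = T κ' u' := funext fun κ => funext fun u => hsym κ u κ' u'
    rw [hTs]
  rw [divW_lin4 hK hδ c hT hH, e, ← two_smul ℝ, smul_smul]
  congr 1
  ring

end Lin

/-! ## §3 The comb ∕ wall instance: (hH) discharged with the `j`-free constant `(Lc^{d+1})⁻¹` -/

section Comb

variable {Lc : ℕ} [NeZero Lc] {r : Fin (d + 1) → ℕ}

omit [NeZero Lc] in
/-- [folklore] `sfStep Lc j · smStep d Lc j = stepScale d Lc j` (`Lc^j · Lc^{j(d+1)} = (Lc^j)^{d+2}`). -/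
theorem sfStep_mul_smStep (j : ℕ) : sfStep Lc j * smStep d Lc j = stepScale d Lc j := by
  simp only [sfStep, smStep, stepScale, ← pow_mul, ← pow_add]
  congr 1
  ring

/-- [folklore] **(hH) FOR THE NORMALISED CO-DRESSED STEP RESOLVENT, `j`-FREE CONSTANT**: for every `j` and every in-block root `r`,
`Σ_μ (colH K♮ᴱ_j Lc μ (y − e_μ) κ′ u − colH K♮ᴱ_j Lc μ y κ′ u) = (Lc^{d+1})⁻¹ · gaugeWt Lc y κ′ u`,
`K♮ᴱ_j := unitK (sfStep Lc j) (smStep d Lc j) (coDressKBmAt (toSite r) Lc (KInvStep Lc j))` (d1-leaf-07's `colH_ward_KInvStep_all` × asym1's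
`colH_unitK`: the units' factor `sfStep·smStep = stepScale` cancels the `stepScale` of `c_H(j) = (stepScale·Lc^{d+1})⁻¹`). -/
theorem hH_unitK_comb (hr : r ∈ box (d + 1) Lc) (j : ℕ) (y : Fin (d + 1) → ℤ) (κ' : Fin (d + 1)) (u : Fin (d + 1) → ℤ) :
    ∑ μ, (colH (unitK (sfStep Lc j) (smStep d Lc j) (coDressKBmAt (toSite r) Lc (KInvStep (d := d) Lc j))) Lc μ (y - unitVec μ) κ' u
        - colH (unitK (sfStep Lc j) (smStep d Lc j) (coDressKBmAt (toSite r) Lc (KInvStep (d := d) Lc j))) Lc μ y κ' u)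
      = ((Lc : ℝ) ^ (d + 1))⁻¹ * gaugeWt Lc y κ' u := by
  have hs : stepScale d Lc j ≠ 0 := by
    simp only [stepScale]
    exact pow_ne_zero _ (pow_ne_zero _ (Nat.cast_ne_zero.2 (NeZero.ne Lc)))
  simp only [colH_unitK, Pi.smul_apply, smul_eq_mul, ← mul_sub, ← Finset.mul_sum]
  rw [colH_ward_KInvStep_all hr j y κ' u, sfStep_mul_smStep, mul_inv, ← mul_assoc, ← mul_assoc, mul_inv_cancel₀ hs, one_mul]

/-- [folklore] **T-EQ, SOURCE SLOT, FOR THE DRESSED COMB STEP** (every `j`, every in-block root `r`, every bounded bi-table `T`, any `c`):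
with `K♮ᴱ_j := unitK (sfStep Lc j) (smStep d Lc j) (coDressKBmAt (toSite r) Lc (KInvStep Lc j))`, `divW (lin4 c K♮ᴱ_j Lc T) y ν y′ = (c·(Lc^{d+1})⁻¹ ∕ 2) • (e3OfK Lc K♮ᴱ_j F₁ ν y′ + e3OfK Lc K♮ᴱ_j F₂ ν y′)`. -/
theorem divW_lin4_comb (hr : r ∈ box (d + 1) Lc) (j : ℕ) (c : ℝ)
    {T : Fin (d + 1) → (Fin (d + 1) → ℤ) → Fin (d + 1) → (Fin (d + 1) → ℤ) → MKer (d + 1) (Fib d)} {B : ℝ}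
    (hT : ∀ κ u κ' u' x z a b, |T κ u κ' u' x z a b| ≤ B) (y : Fin (d + 1) → ℤ) (ν : Fin (d + 1)) (y' : Fin (d + 1) → ℤ) :
    divW (lin4 c (unitK (sfStep Lc j) (smStep d Lc j) (coDressKBmAt (toSite r) Lc (KInvStep (d := d) Lc j))) Lc T) y ν y'
      = (c * ((Lc : ℝ) ^ (d + 1))⁻¹ / 2) •
        (e3OfK Lc (unitK (sfStep Lc j) (smStep d Lc j) (coDressKBmAt (toSite r) Lc (KInvStep (d := d) Lc j)))
            (fun κ' u' => ∑ v ∈ box (d + 1) Lc, divV (fun κ u => T κ u κ' u') ((Lc : ℤ) • y + toSite v)) ν y'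
          + e3OfK Lc (unitK (sfStep Lc j) (smStep d Lc j) (coDressKBmAt (toSite r) Lc (KInvStep (d := d) Lc j)))
            (fun κ u => ∑ v ∈ box (d + 1) Lc, divV (T κ u) ((Lc : ℤ) • y + toSite v)) ν y') := by
  obtain ⟨δK, CK, hδK, -, hG⟩ := decays_coDressKBmAt_KInvStep (d := d) hr j
  exact divW_lin4 (decays_unitK hG) hδK c hT (hH_unitK_comb hr j) y ν y'

/-- [folklore] **… AND FOR A SYMMETRIC TABLE**: `divW (lin4 c K♮ᴱ_j Lc T) y ν y′ = (c·(Lc^{d+1})⁻¹) • e3OfK Lc K♮ᴱ_j (κ u ↦ Σ_{v ∈ box} divV (T κ u) (Lc•y + toSite v)) ν y′`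
— the slot divergence of the dressed comb step's linear map is `(c·Lc^{−(d+1)}) ×` the S-slot map of the SAME normalised co-dressed resolvent
applied to the block-summed fine slot divergence, at every level with the same constant. -/
theorem divW_lin4_comb_of_symm (hr : r ∈ box (d + 1) Lc) (j : ℕ) (c : ℝ)
    {T : Fin (d + 1) → (Fin (d + 1) → ℤ) → Fin (d + 1) → (Fin (d + 1) → ℤ) → MKer (d + 1) (Fib d)} {B : ℝ}
    (hT : ∀ κ u κ' u' x z a b, |T κ u κ' u' x z a b| ≤ B) (hsym : ∀ κ u κ' u', T κ u κ' u' = T κ' u' κ u)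
    (y : Fin (d + 1) → ℤ) (ν : Fin (d + 1)) (y' : Fin (d + 1) → ℤ) :
    divW (lin4 c (unitK (sfStep Lc j) (smStep d Lc j) (coDressKBmAt (toSite r) Lc (KInvStep (d := d) Lc j))) Lc T) y ν y'
      = (c * ((Lc : ℝ) ^ (d + 1))⁻¹) •
        e3OfK Lc (unitK (sfStep Lc j) (smStep d Lc j) (coDressKBmAt (toSite r) Lc (KInvStep (d := d) Lc j)))
          (fun κ u => ∑ v ∈ box (d + 1) Lc, divV (T κ u) ((Lc : ℤ) • y + toSite v)) ν y' := by
  obtain ⟨δK, CK, hδK, -, hG⟩ := decays_coDressKBmAt_KInvStep (d := d) hr j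
  exact divW_lin4_of_symm (decays_unitK hG) hδK c hT hsym (hH_unitK_comb hr j) y ν y'

end Comb

end Summit.QuantumFields.BalabanUV.Beta.GAN24.Lin4SlotDivergence

end
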